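import Literature.NumberTheory.GaloisRepresentations.IdeleReadoutAssembly
import Literature.NumberTheory.GaloisRepresentations.IdelePlaceReadout
import Literature.NumberTheory.GaloisRepresentations.GalLayerSystemLayerLift
import HarnessLib

/-!
# An equivariant homomorphism `X ⟶ J̄` in `C_Γ` from local equivariant homomorphisms `X → K̄_vˣ` at all places
# (`Hom_{C_Γ}(N₁, J̄) = Hom_{Gal(E/K)}(N₁, J_E) = ∏'_v Hom_{Γ_{K_v}}(N₁, K̄_vˣ)`; Milne *ADT* I Lemma 4.13; Tate, C–F VII §8–§9)

Topic `NumberTheory/GaloisRepresentations`; namespace `Literature.NumberTheory.GaloisRepresentations.IdeleReadout`.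
Definitions with bodies and theorems; NO named fact, no `sorry`, no instance, no notation; number fields in `Type`.
The packaging of door-c5 g17's `IdeleReadoutAssembly` (`ideleHomOfLocalHoms : X ⟶ ideleRep K E` at a finite Galois
layer) for door-c4's category `C_Γ = DiscreteRepCat ℤ Γ_K` and door-c5 g16's `J̄ = ideleBarD K`: an object `X` of `C_Γ` on
which `U_E = Gal(K̄/E)` acts trivially IS a `Gal(E/K)`-module (`descendRep`), its `C_Γ`-morphisms into `J̄ = lim→ J_E` ARE
its `Gal(E/K)`-morphisms into `J_E` (`GalLayerData.ofLayerHom` / `layerLift`, Tate VII §8 Prop. 8.1), and the latter are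
assembled from local data by `ideleHomOfLocalHoms`.

Why (Route A of crux `AnticycControlAdditiveK`, item 19295): THIS is hypothesis (R3) of door-c6 g16's
`middleExact_allPlaces_of_readout` on the idèle side, in the currency of that theorem (`S.X₁ : DiscreteRepCat ℤ Γ_K`,
`f : S.X₁ ⟶ (ideleClassLimitShortComplex K).X₂ = ideleBarD K`), with the readouts `π_v` of `IdelePlaceReadout`
(the layer form of (R-def)): **given `Γ_{K_v}`-equivariant `h_v : X → K̄_vˣ` at every place, unit-valued at the finite
places off a finite `T`, there is `f : X ⟶ J̄` whose layer-`E` lift has readouts `π_v ∘ f_E = h_v` at every place.**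
The local `h_v` are what door-c6's `HomDual.dualδ₀_units_restrict_surjective` / `exists_algNorm_eq_one_of_unramified`
provide.  HONEST FRAMING: no case of Poitou–Tate or BSD is proved here.

## What is formalised (`K : Type` number field, `E : GalLayer K`, `X : DiscreteRepCat ℤ Γ_K`, `hX : U_E` acts trivially)

* `layerEmb E : E →ₐ[K] K̄` (the inclusion), **`galRestrictField_layerEmb`** (`d|_E = E.restrictHom (res d)`).
* **`descendρ` / `descendRep E X hX : Rep ℤ Gal(E/K)`** (`descendρ_restrictHom : ρ_E(σ|_E) = ρ(σ)`).
* `IsPlaceLocalHom` / `IsInfPlaceLocalHom` (the `Γ`-level equivariance of `h_v`: `h (res_v d • x) = d • h x`),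
  `isLocalHom_descendRep`, `isArchLocalHom_descendRep`.
* **`layerIdeleHom` : `descendRep E X hX ⟶ ideleRep K E`**, **`ideleBarHomOfLocalHoms : X ⟶ ideleBarD K`**,
  `layerLift_ideleBarHomOfLocalHoms`, **`idelePlaceReadout_layerLift_ideleBarHomOfLocalHoms`** (`π_v (f_E x) = h_v x`,
  finite `v`), **`ideleInfPlaceReadout_layerLift_ideleBarHomOfLocalHoms`** (infinite `v`),
  **`exists_ideleBarD_hom_of_localHoms`** (the (R3)-shaped existence statement).

## References
* J. S. Milne, *Arithmetic Duality Theorems* (2nd ed. 2006), I Lemma 4.13 and the proof of Thm. 4.10 (p. 58). [MilneADT2006]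
* J. W. S. Cassels, A. Fröhlich (eds.), *Algebraic Number Theory* (1967), Ch. VII (Tate) §8 Prop. 8.1, §9.7. [CasselsFrohlichANT1967]
* D. Harari, *Galois Cohomology and Class Field Theory* (2020), §13.1, §17.3. [Harari2020]
-/

noncomputable section

open NumberField NumberField.InfinitePlace IsDedekindDomain Field CategoryTheory
open Literature.NumberTheory.Automorphic

namespace Literature.NumberTheory.GaloisRepresentations

namespace IdeleReadout

open SemiLocal ArchHerbrand DiscreteGaloisModule IdeleCohomology IdeleClassBar Literature.Algebra.Homology

variable {K : Type} [Field K] [NumberField K] (E : GalLayer K)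

/-! ## §1. The layer embedding and the restriction maps -/

/-- **The embedding `ιE : E → K̄` of a layer** (the inclusion of the intermediate field). [cite: CasselsFrohlichANT1967, Ch. VII §8] -/
abbrev layerEmb : E.1 →ₐ[K] AlgebraicClosure K := E.1.val

omit [NumberField K] in
/-- **`d|_E = E.restrictHom (d|_{K̄})`**: for a layer, the restriction `galRestrictField L ιE` of `IdeleReadout` is door-c5's
`GalLayer.restrictHom` after `absGaloisRestrict`. [cite: CasselsFrohlichANT1967, Ch. VII §1.1] -/
theorem galRestrictField_layerEmb (L : Type) [Field L] [Algebra K L] (d : absoluteGaloisGroup L) :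
    (haveI := E.isGalois; galRestrictField L (layerEmb E) d) = E.restrictHom (absGaloisRestrict K L d) := by
  haveI := E.isGalois
  exact (eq_galRestrictField L (layerEmb E) fun e => (GalLayer.coe_restrictHom_apply E _ e)).symm

/-- Finite places: `galRestrict v ιE d = E.restrictHom (res_v d)`. [cite: CasselsFrohlichANT1967, Ch. VII §1.1] -/
theorem galRestrict_layerEmb (v : HeightOneSpectrum (𝓞 K)) (d : absoluteGaloisGroup (v.adicCompletion K)) :
    (haveI := E.isGalois; haveI := E.numberField; galRestrict v (layerEmb E) d) =
      E.restrictHom (absGaloisRestrict K (v.adicCompletion K) d) :=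
  galRestrictField_layerEmb E (v.adicCompletion K) d

/-! ## §2. A `U_E`-trivial object of `C_Γ` is a `Gal(E/K)`-module -/

variable (X : DiscreteRepCat ℤ (absoluteGaloisGroup K))
  (hX : ∀ σ ∈ E.openNormalSubgroup, ∀ x : X.obj.V, X.obj.ρ σ x = x)

omit [NumberField K] in
include hX in
/-- `U_E ≤ ker ρ`. [cite: CasselsFrohlichANT1967, Ch. VII §8 Prop. 8.1] -/
theorem openNormalSubgroup_le_ker : (E.openNormalSubgroup : Subgroup (absoluteGaloisGroup K)) ≤ X.obj.ρ.ker := by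
  letI : Module ℤ X.obj.V := X.obj.hV2
  exact fun σ hσ => LinearMap.ext fun x => hX σ hσ x

/-- **The descended representation of `Gal(E/K)` on `X`**: `ρ_E(g) := ρ(σ)` for any `σ` with `σ|_E = g`
(`Γ_K ⧸ U_E ≃* Gal(E/K)`, door-c5 `GalLayer.quotEquiv`). [cite: CasselsFrohlichANT1967, Ch. VII §8 Prop. 8.1] -/
def descendρ : letI : Module ℤ X.obj.V := X.obj.hV2; Representation ℤ (E.1 ≃ₐ[K] E.1) X.obj.V :=
  letI : Module ℤ X.obj.V := X.obj.hV2
  (QuotientGroup.lift _ X.obj.ρ (openNormalSubgroup_le_ker E X hX)).comp E.quotEquiv.symm.toMonoidHom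

/-- **`ρ_E(σ|_E) = ρ(σ)`.** [cite: CasselsFrohlichANT1967, Ch. VII §8 Prop. 8.1] -/
theorem descendρ_restrictHom (σ : absoluteGaloisGroup K) : descendρ E X hX (E.restrictHom σ) = X.obj.ρ σ := by
  letI : Module ℤ X.obj.V := X.obj.hV2
  change QuotientGroup.lift _ X.obj.ρ (openNormalSubgroup_le_ker E X hX) (E.quotEquiv.symm (E.restrictHom σ)) = _
  rw [GalLayer.quotEquiv_symm_restrictHom]
  rfl

/-- Elementwise. [cite: CasselsFrohlichANT1967, Ch. VII §8 Prop. 8.1] -/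
theorem descendρ_restrictHom_apply (σ : absoluteGaloisGroup K) (x : X.obj.V) :
    descendρ E X hX (E.restrictHom σ) x = X.obj.ρ σ x := by
  rw [descendρ_restrictHom]

/-- **`X` as a `Gal(E/K)`-module** (`Rep ℤ Gal(E/K)`, same underlying module and `ℤ`-structure).
[cite: CasselsFrohlichANT1967, Ch. VII §8 Prop. 8.1] -/
def descendRep : Rep.{0} ℤ (E.1 ≃ₐ[K] E.1) :=
  @Rep.of ℤ (E.1 ≃ₐ[K] E.1) _ _ X.obj.V X.obj.hV1 X.obj.hV2 (descendρ E X hX)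

/-! ## §3. Local equivariant homomorphisms, at the `Γ`-level -/

/-- **A `Γ_{K_v}`-equivariant `h : X → K̄_vˣ` at a finite place** (`Γ_{K_v}` acting on `X` through `res_v : Γ_{K_v} → Γ_K`):
the naive form of an invariant of `Hom(X|_{Γ_{K_v}}, units K_v)`. [cite: MilneADT2006, I Lemma 4.13 (proof)] -/
def IsPlaceLocalHom (v : HeightOneSpectrum (𝓞 K)) (h : X.obj.V →+ UnitsCarrier (v.adicCompletion K)) : Prop :=
  ∀ (d : absoluteGaloisGroup (v.adicCompletion K)) (x : X.obj.V),
    h (X.obj.ρ (absGaloisRestrict K (v.adicCompletion K) d) x) = units (v.adicCompletion K) d (h x)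

/-- **A `Γ_{K_v}`-equivariant `h : X → K̄_vˣ` at an infinite place.** [cite: MilneADT2006, I Lemma 4.13 (proof)] -/
def IsInfPlaceLocalHom (v : InfinitePlace K) (h : X.obj.V →+ UnitsCarrier v.Completion) : Prop :=
  ∀ (d : absoluteGaloisGroup v.Completion) (x : X.obj.V),
    h (X.obj.ρ (absGaloisRestrict K v.Completion d) x) = units v.Completion d (h x)

variable {X hX}

/-- `Γ`-level equivariance is `IsLocalHom` for the descended module. [cite: MilneADT2006, I Lemma 4.13 (proof)] -/
theorem isLocalHom_descendRep {v : HeightOneSpectrum (𝓞 K)} {h : X.obj.V →+ UnitsCarrier (v.adicCompletion K)}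
    (hh : IsPlaceLocalHom X v h) :
    haveI := E.isGalois; haveI := E.numberField; IsLocalHom v (layerEmb E) (descendRep E X hX) h := by
  haveI := E.isGalois
  haveI := E.numberField
  intro d x
  change h (descendρ E X hX (galRestrict v (layerEmb E) d) x) = _
  rw [galRestrict_layerEmb, descendρ_restrictHom_apply]
  exact hh d x

/-- `Γ`-level equivariance is `IsArchLocalHom` for the descended module. [cite: MilneADT2006, I Lemma 4.13 (proof)] -/
theorem isArchLocalHom_descendRep {v : InfinitePlace K} {h : X.obj.V →+ UnitsCarrier v.Completion}
    (hh : IsInfPlaceLocalHom X v h) :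
    haveI := E.isGalois; IsArchLocalHom v (layerEmb E) (descendRep E X hX) h := by
  haveI := E.isGalois
  intro d x
  change h (descendρ E X hX (galRestrictField v.Completion (layerEmb E) d) x) = _
  rw [galRestrictField_layerEmb, descendρ_restrictHom_apply]
  exact hh d x

/-! ## §4. The morphisms `X ⟶ J_E` and `X ⟶ J̄` from local data -/

section Assembly

variable (hX) (T : Finset (HeightOneSpectrum (𝓞 K)))
  {hfin : ∀ v : HeightOneSpectrum (𝓞 K), X.obj.V →+ UnitsCarrier (v.adicCompletion K)}
  (hfinEq : ∀ v : HeightOneSpectrum (𝓞 K), IsPlaceLocalHom X v (hfin v))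
  (hunit : ∀ v : HeightOneSpectrum (𝓞 K), v ∉ T → ∀ x : X.obj.V,
    IsNonarchimedeanLocalField.algNorm (v.adicCompletion K)
      (unitsVal (v.adicCompletion K) (hfin v x) : AlgebraicClosure (v.adicCompletion K)) = 1)
  {hinf : ∀ v : InfinitePlace K, X.obj.V →+ UnitsCarrier v.Completion}
  (hinfEq : ∀ v : InfinitePlace K, IsInfPlaceLocalHom X v (hinf v))

/-- **The `Gal(E/K)`-morphism `X ⟶ J_E` assembled from the local homomorphisms.** [cite: MilneADT2006, I Lemma 4.13 (proof)] -/
def layerIdeleHom :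
    haveI := E.numberField
    descendRep E X hX ⟶ IdeleClassGroup.ideleRep K E.1 :=
  haveI := E.numberField
  haveI := E.isGalois
  ideleHomOfLocalHoms (layerEmb E) T (fun v => isLocalHom_descendRep E (hfinEq v)) hunit
    (fun v => isArchLocalHom_descendRep E (hinfEq v))

/-- The assembled layer morphism as an additive map `X → J_E` (the datum of `GalLayerData.ofLayerHom`).
[cite: CasselsFrohlichANT1967, Ch. VII §8 Prop. 8.1] -/
def layerIdeleAddHom : X.obj.V →+ (ideleData K).V E :=
  AddMonoidHom.mk' (fun x => (layerIdeleHom E hX T hfinEq hunit hinfEq).hom x) fun x y =>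
    map_add (layerIdeleHom E hX T hfinEq hunit hinfEq).hom x y

/-- Unfolding. [cite: CasselsFrohlichANT1967, Ch. VII §8 Prop. 8.1] -/
theorem layerIdeleAddHom_apply (x : X.obj.V) :
    layerIdeleAddHom E hX T hfinEq hunit hinfEq x = (layerIdeleHom E hX T hfinEq hunit hinfEq).hom x := rfl

/-- Equivariance of the layer map along `Γ_K → Gal(E/K)`. [cite: CasselsFrohlichANT1967, Ch. VII §8 Prop. 8.1] -/
theorem layerIdeleAddHom_ρ (σ : absoluteGaloisGroup K) (x : X.obj.V) :
    layerIdeleAddHom E hX T hfinEq hunit hinfEq (X.obj.ρ σ x) =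
      (ideleData K).ρ E (E.restrictHom σ) (layerIdeleAddHom E hX T hfinEq hunit hinfEq x) := by
  rw [layerIdeleAddHom_apply, layerIdeleAddHom_apply, ← descendρ_restrictHom_apply E X hX]
  exact Rep.hom_comm_apply (layerIdeleHom E hX T hfinEq hunit hinfEq) (E.restrictHom σ) x

/-- **The `C_Γ`-morphism `X ⟶ J̄` assembled from the local homomorphisms** (`GalLayerData.ofLayerHom` of the layer
morphism). [cite: MilneADT2006, I Lemma 4.13 (proof)] [cite: CasselsFrohlichANT1967, Ch. VII §8 Prop. 8.1, §9.7] -/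
def ideleBarHomOfLocalHoms : X ⟶ ideleBarD K :=
  (ideleData K).ofLayerHom E (layerIdeleAddHom E hX T hfinEq hunit hinfEq) (layerIdeleAddHom_ρ E hX T hfinEq hunit hinfEq)

/-- **Its layer-`E` lift is the assembled layer morphism.** [cite: CasselsFrohlichANT1967, Ch. VII §8 Prop. 8.1] -/
theorem layerLift_ideleBarHomOfLocalHoms (x : X.obj.V) :
    (ideleData K).layerLift E hX (ideleBarHomOfLocalHoms E hX T hfinEq hunit hinfEq) x =
      (layerIdeleHom E hX T hfinEq hunit hinfEq).hom x :=
  GalLayerData.layerLift_ofLayerHom _ E hX _ _ x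

/-- **Readout at a finite place: `π_v (f_E x) = h_v x`.** [cite: MilneADT2006, I Lemma 4.13 (proof)] -/
theorem idelePlaceReadout_layerLift_ideleBarHomOfLocalHoms (v : HeightOneSpectrum (𝓞 K)) (x : X.obj.V) :
    (haveI := E.numberField; haveI := E.isGalois;
      idelePlaceReadout v (layerEmb E) ((ideleData K).layerLift E hX (ideleBarHomOfLocalHoms E hX T hfinEq hunit hinfEq) x)) =
      hfin v x := by
  haveI := E.numberField
  haveI := E.isGalois
  rw [layerLift_ideleBarHomOfLocalHoms, ← localReadout_comp_placeProj_apply]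
  exact DFunLike.congr_fun (localReadout_ideleHomOfLocalHoms_placeProj (layerEmb E) T
    (fun v => isLocalHom_descendRep E (hfinEq v)) hunit (fun v => isArchLocalHom_descendRep E (hinfEq v)) v) x

/-- **Readout at an infinite place: `π_v (f_E x) = h_v x`.** [cite: MilneADT2006, I Lemma 4.13 (proof)] -/
theorem ideleInfPlaceReadout_layerLift_ideleBarHomOfLocalHoms (v : InfinitePlace K) (x : X.obj.V) :
    (haveI := E.numberField; haveI := E.isGalois;
      ideleInfPlaceReadout v (layerEmb E) ((ideleData K).layerLift E hX (ideleBarHomOfLocalHoms E hX T hfinEq hunit hinfEq) x)) =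
      hinf v x := by
  haveI := E.numberField
  haveI := E.isGalois
  rw [layerLift_ideleBarHomOfLocalHoms, ← archLocalReadout_comp_infPlaceProj_apply]
  exact DFunLike.congr_fun (archLocalReadout_ideleHomOfLocalHoms_infPlaceProj (layerEmb E) T
    (fun v => isLocalHom_descendRep E (hfinEq v)) hunit (fun v => isArchLocalHom_descendRep E (hinfEq v)) v) x

include hfinEq hunit hinfEq in
/-- **(R3), idèle side, in `C_Γ`-currency**: from `Γ_{K_v}`-equivariant `h_v : X → K̄_vˣ` at every place of `K`,
unit-valued at the finite places outside a finite `T`, an equivariant `f : X ⟶ J̄` whose layer-`E` lift has place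
readouts `π_v ∘ f_E = h_v` everywhere. [cite: MilneADT2006, I Lemma 4.13] [cite: CasselsFrohlichANT1967, Ch. VII §8 Prop. 8.1] -/
theorem exists_ideleBarD_hom_of_localHoms :
    ∃ f : X ⟶ ideleBarD K,
      (∀ (v : HeightOneSpectrum (𝓞 K)) (x : X.obj.V),
        (haveI := E.numberField; haveI := E.isGalois;
          idelePlaceReadout v (layerEmb E) ((ideleData K).layerLift E hX f x)) = hfin v x) ∧
      (∀ (v : InfinitePlace K) (x : X.obj.V),
        (haveI := E.numberField; haveI := E.isGalois;
          ideleInfPlaceReadout v (layerEmb E) ((ideleData K).layerLift E hX f x)) = hinf v x) :=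
  ⟨ideleBarHomOfLocalHoms E hX T hfinEq hunit hinfEq,
    fun v x => idelePlaceReadout_layerLift_ideleBarHomOfLocalHoms E hX T hfinEq hunit hinfEq v x,
    fun v x => ideleInfPlaceReadout_layerLift_ideleBarHomOfLocalHoms E hX T hfinEq hunit hinfEq v x⟩

end Assembly

end IdeleReadout

end Literature.NumberTheory.GaloisRepresentations

end
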